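import Mathlib.Combinatorics.SimpleGraph.Metric
import Mathlib.Combinatorics.SimpleGraph.Walk.Counting
import Mathlib.Combinatorics.SimpleGraph.DeleteEdges
import Literature.Probability.Percolation.ConstrainedClusters
import HarnessLib

/-!
# Chemical (intrinsic) distance in bond percolation: balls, levels, and the far-level event

Topic `Literature/Probability/Percolation`.  Kozma–Nachmias, *The Alexander–Orbach conjecture holds
in high dimensions*, Invent. Math. 178 (2009) 635–654, §1.3 and §3.2, work with the INTRINSIC
(graph, "chemical") metric of the open cluster: for a sub-edge-set `G ⊂ E(ℤ^d)`, `B(x, r; G)` is the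
set of sites joined to `x` by an open path of `G`-edges of length `≤ r`, `∂B(x, r; G)` the sites at
chemical distance exactly `r`, `H(r; G) = {∂B(0, r; G) ≠ ∅}` and `Γ(r) = sup_G P(H(r; G))` (their
§1.3; the supremum over subgraphs is what makes the "regeneration" / Markov-property argument of
§3.2 work, see their discussion after Thm. 1.3).

This file sets these notions up, sorry-free, for the tree's bond configurations `ω : BondConfig V`
(`Percolation.lean`) with the step constraint expressed by a step graph `K : SimpleGraph V` exactly as in
`ConstrainedClusters.lean` (`openClusterIn K ω x`, the cluster of the restricted configuration
`ω ∩ E(K)`; the open `K`-graph is `openGraph ω ⊓ K`):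

* `Chemical.ball K v i ω` — `B(v, i; K)`, the sites joined to `v` by an open `K`-path of length `≤ i`;
* `Chemical.level K v i ω` — `∂B(v, i; K)`, the sites at chemical distance exactly `i`;
* `Chemical.far K v r` — the EVENT `{∂B(v, r; K) ≠ ∅}` (some site of the `K`-cluster of `v` lies at
  chemical distance `≥ r`; equivalently exactly `r`, levels below a non-empty level being non-empty);
* deterministic API: balls versus `SimpleGraph.dist`, monotonicity, the vertices of a geodesic sit one
  per level (`dist_getVert_of_length_eq_dist`), the pigeonhole "thin level" lemma
  (`exists_thin_level`: if `|C_K(v)| ≤ V` some level `j ∈ [m, 2m)` has `≤ V/m` sites — KN09 §3.2),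
  the LOCALITY lemma `ball_eq_of_agree` (the balls `B(v, i; K)`, `i ≤ n+1`, are read off the `K`-edges
  touching `B(v, n; K)` — the measurability half of the regeneration argument), the GEODESIC-SUFFIX
  lemma `exists_far_deleteEdges` (a geodesic leaving `B(v, n; K)` continues in the graph with all edges
  touching `B(v, n; K)` deleted — the other half), and `DeterminedBy` / measurability of `far`.

The probabilistic statement these serve (KN09 §3.2, claim inside the proof of Thm. 1.2(ii)) is in
`ChemicalOneArmRecursion.lean`.

## References

* G. Kozma, A. Nachmias, *The Alexander–Orbach conjecture holds in high dimensions*, Invent. Math.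
  178 (2009), §1.3 (intrinsic balls, `H(r;G)`, `Γ(r)`, Thm. 1.2), §3.2 (thin levels, regeneration).
* G. Grimmett, *Percolation*, 2nd ed. 1999, §2.2 (events determined by a set of edges).
-/

noncomputable section

namespace Literature.Probability.Percolation

open MeasureTheory

namespace Chemical

variable {V : Type*}

/-! ## Intrinsic balls, levels, and the far-level event -/

/-- The intrinsic ball `B(v, i; K)`: the sites joined to `v` by an open path all of whose steps are
edges of `K`, of length at most `i` (Kozma–Nachmias 2009, §1.3, with `G = E(K)`).
[cite: KozmaNachmias2009, §1.3 (definition of B(x,r;G))] -/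
def ball (K : SimpleGraph V) (v : V) (i : ℕ) (ω : BondConfig V) : Set V :=
  {z | ∃ w : (openGraph ω ⊓ K).Walk v z, w.length ≤ i}

/-- The level `∂B(v, i; K)`: the sites of the `K`-cluster of `v` at chemical distance exactly `i`
from `v` (Kozma–Nachmias 2009, §1.3: the sites at intrinsic distance exactly `r`).
[cite: KozmaNachmias2009, §1.3 (definition of ∂B(x,r;G))] -/
def level (K : SimpleGraph V) (v : V) (i : ℕ) (ω : BondConfig V) : Set V :=
  {z | (openGraph ω ⊓ K).Reachable v z ∧ (openGraph ω ⊓ K).dist v z = i}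

/-- The event `H_v(r; K) = {∂B(v, r; K) ≠ ∅}`: some site of the `K`-cluster of `v` lies at chemical
distance at least `r` from `v` (Kozma–Nachmias 2009, §1.3, written with `≥ r`; the two forms agree
since the levels below a non-empty level are non-empty, `level_nonempty_of_far`).
[cite: KozmaNachmias2009, §1.3 (definition of H(r;G))] -/
def far (K : SimpleGraph V) (v : V) (r : ℕ) : Set (BondConfig V) :=
  {ω | ∃ z, (openGraph ω ⊓ K).Reachable v z ∧ r ≤ (openGraph ω ⊓ K).dist v z}

/-! ## Balls versus the graph distance -/

/-- `z ∈ B(v, i; K)` iff `z` is reachable at chemical distance `≤ i`. [cite: KozmaNachmias2009, §1.3 (intrinsic balls, levels and H(r;G))] -/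
theorem mem_ball_iff {K : SimpleGraph V} {v z : V} {i : ℕ} {ω : BondConfig V} :
    z ∈ ball K v i ω ↔ (openGraph ω ⊓ K).Reachable v z ∧ (openGraph ω ⊓ K).dist v z ≤ i := by
  constructor
  · rintro ⟨w, hw⟩
    exact ⟨⟨w⟩, (SimpleGraph.dist_le w).trans hw⟩
  · rintro ⟨hr, hd⟩
    obtain ⟨w, hw⟩ := hr.exists_walk_length_eq_dist
    exact ⟨w, hw ▸ hd⟩

/-- The balls increase with the radius. [cite: KozmaNachmias2009, §1.3 (intrinsic balls, levels and H(r;G))] -/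
theorem ball_mono {K : SimpleGraph V} {v : V} {i i' : ℕ} (h : i ≤ i') (ω : BondConfig V) :
    ball K v i ω ⊆ ball K v i' ω := fun _ ⟨w, hw⟩ => ⟨w, hw.trans h⟩

/-- `v ∈ B(v, i; K)`. [cite: KozmaNachmias2009, §1.3 (intrinsic balls, levels and H(r;G))] -/
theorem self_mem_ball (K : SimpleGraph V) (v : V) (i : ℕ) (ω : BondConfig V) : v ∈ ball K v i ω :=
  ⟨SimpleGraph.Walk.nil, by simp⟩

/-- Balls lie in the constrained cluster `C_K(v)`. [cite: KozmaNachmias2009, §1.3 (intrinsic balls, levels and H(r;G))] -/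
theorem ball_subset_openClusterIn (K : SimpleGraph V) (v : V) (i : ℕ) (ω : BondConfig V) :
    ball K v i ω ⊆ openClusterIn K ω v := fun _ ⟨w, _⟩ => mem_openClusterIn_iff.2 ⟨w⟩

/-- Levels lie in the constrained cluster `C_K(v)`. [cite: KozmaNachmias2009, §1.3 (intrinsic balls, levels and H(r;G))] -/
theorem level_subset_openClusterIn (K : SimpleGraph V) (v : V) (i : ℕ) (ω : BondConfig V) :
    level K v i ω ⊆ openClusterIn K ω v := fun _ h => mem_openClusterIn_iff.2 h.1

/-- A level lies in the ball of the same radius. [cite: KozmaNachmias2009, §1.3 (intrinsic balls, levels and H(r;G))] -/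
theorem level_subset_ball (K : SimpleGraph V) (v : V) (i : ℕ) (ω : BondConfig V) :
    level K v i ω ⊆ ball K v i ω := fun _ h => mem_ball_iff.2 ⟨h.1, h.2.le⟩

/-- A site of level `i ≥ 1` is not in the ball of radius `i - 1`. [cite: KozmaNachmias2009, §1.3 (intrinsic balls, levels and H(r;G))] -/
theorem not_mem_ball_of_mem_level {K : SimpleGraph V} {v z : V} {i n : ℕ} {ω : BondConfig V}
    (hz : z ∈ level K v i ω) (hn : n < i) : z ∉ ball K v n ω := fun h =>
  absurd (mem_ball_iff.1 h).2 (by rw [hz.2]; omega)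

/-- Distinct levels are disjoint. [cite: KozmaNachmias2009, §1.3 (intrinsic balls, levels and H(r;G))] -/
theorem disjoint_level {K : SimpleGraph V} {v : V} {i i' : ℕ} (h : i ≠ i') (ω : BondConfig V) :
    Disjoint (level K v i ω) (level K v i' ω) :=
  Set.disjoint_left.2 fun _ hz hz' => h (hz.2.symm.trans hz'.2)

/-- The far-level events decrease in `r`. [cite: KozmaNachmias2009, §1.3 (intrinsic balls, levels and H(r;G))] -/
theorem far_antitone (K : SimpleGraph V) (v : V) : Antitone (far K v) :=
  fun _ _ h _ ⟨z, hz, hrz⟩ => ⟨z, hz, h.trans hrz⟩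

/-- `H_v(0; K)` is the sure event. [cite: KozmaNachmias2009, §1.3 (intrinsic balls, levels and H(r;G))] -/
theorem far_zero (K : SimpleGraph V) (v : V) : far K v 0 = Set.univ :=
  Set.eq_univ_of_forall fun _ => ⟨v, SimpleGraph.Reachable.refl _, Nat.zero_le _⟩

/-- A non-empty level `i ≥ r` witnesses `H_v(r; K)`. [cite: KozmaNachmias2009, §1.3 (intrinsic balls, levels and H(r;G))] -/
theorem mem_far_of_mem_level {K : SimpleGraph V} {v z : V} {i r : ℕ} {ω : BondConfig V}
    (hz : z ∈ level K v i ω) (hr : r ≤ i) : ω ∈ far K v r :=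
  ⟨z, hz.1, hz.2.symm ▸ hr⟩

/-! ## Geodesics: one vertex per level -/

/-- **The vertices of a geodesic sit one per level**: if `w` is a walk from `u` to `z` of length
`dist(u, z)`, its `i`-th vertex is at distance exactly `i` from `u` (`i ≤ |w|`). [cite: KozmaNachmias2009, §1.3 (intrinsic balls, levels and H(r;G))] -/
theorem dist_getVert_of_length_eq_dist {G : SimpleGraph V} {u z : V} (w : G.Walk u z)
    (hw : w.length = G.dist u z) {i : ℕ} (hi : i ≤ w.length) : G.dist u (w.getVert i) = i := by
  apply le_antisymm
  · have h := SimpleGraph.dist_le (w.take i)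
    rw [SimpleGraph.Walk.take_length] at h
    exact h.trans (min_le_left _ _)
  · have hreach : G.Reachable u (w.getVert i) := ⟨w.take i⟩
    have h1 := hreach.dist_triangle_left z
    have h2 : G.dist (w.getVert i) z ≤ w.length - i := by
      have := SimpleGraph.dist_le (w.drop i)
      rwa [SimpleGraph.Walk.drop_length] at this
    omega

/-- On `H_v(r; K)` every level `i ≤ r` is non-empty (take the `i`-th vertex of a geodesic).
[cite: KozmaNachmias2009, §3.2 (levels of the intrinsic ball)] -/
theorem level_nonempty_of_far {K : SimpleGraph V} {v : V} {r i : ℕ} {ω : BondConfig V}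
    (h : ω ∈ far K v r) (hi : i ≤ r) : (level K v i ω).Nonempty := by
  obtain ⟨z, hz, hrz⟩ := h
  obtain ⟨w, hw⟩ := hz.exists_walk_length_eq_dist
  refine ⟨w.getVert i, ⟨w.take i⟩, dist_getVert_of_length_eq_dist w hw ?_⟩
  rw [hw]; exact hi.trans hrz

/-! ## The thin level (pigeonhole) -/

/-- **Thin level.** If the `K`-cluster of `v` is finite with at most `V` sites, then for every `m ≥ 1`
some level `j ∈ [m, 2m)` has at most `V / m` sites: the `m` levels `∂B(v, j; K)`, `m ≤ j < 2m`, are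
pairwise disjoint subsets of `C_K(v)` (Kozma–Nachmias 2009, §3.2: "if `|C_G(0)| ≤ ε 9^k` then there
must be some level `j ∈ [3^k/3, 2·3^k/3]` such that `|∂B(0,j;G)| ≤ ε 3^{k+1}`").
[cite: KozmaNachmias2009, §3.2 proof of Thm. 1.2(ii) (existence of a thin level)] -/
theorem exists_thin_level {K : SimpleGraph V} {v : V} {ω : BondConfig V} {V₀ : ℝ}
    (hfin : (openClusterIn K ω v).Finite) (hV : ((openClusterIn K ω v).ncard : ℝ) ≤ V₀)
    {m : ℕ} (hm : 1 ≤ m) :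
    ∃ j, m ≤ j ∧ j < 2 * m ∧ (level K v j ω).Finite ∧ ((level K v j ω).ncard : ℝ) ≤ V₀ / m := by
  classical
  have hlf : ∀ j, (level K v j ω).Finite := fun j => hfin.subset (level_subset_openClusterIn K v j ω)
  by_contra! hcon
  have hbig : ∀ j ∈ Finset.Ico m (2 * m), V₀ / m < ((level K v j ω).ncard : ℝ) := fun j hj =>
    hcon j (Finset.mem_Ico.1 hj).1 (Finset.mem_Ico.1 hj).2 (hlf j)
  -- the levels `m ≤ j < 2m` are disjoint subsets of the cluster
  have hsum : (∑ j ∈ Finset.Ico m (2 * m), (level K v j ω).ncard) ≤ (openClusterIn K ω v).ncard := by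
    have hdisj : ∀ x ∈ Finset.Ico m (2 * m), ∀ y ∈ Finset.Ico m (2 * m), x ≠ y →
        Disjoint (hlf x).toFinset (hlf y).toFinset := by
      intro x _ y _ hxy
      rw [Set.Finite.disjoint_toFinset]
      exact disjoint_level hxy ω
    calc (∑ j ∈ Finset.Ico m (2 * m), (level K v j ω).ncard)
        = ∑ j ∈ Finset.Ico m (2 * m), (hlf j).toFinset.card :=
          Finset.sum_congr rfl fun j _ => Set.ncard_eq_toFinset_card _ (hlf j)
      _ = ((Finset.Ico m (2 * m)).biUnion fun j => (hlf j).toFinset).card :=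
          (Finset.card_biUnion hdisj).symm
      _ ≤ hfin.toFinset.card :=
          Finset.card_le_card (Finset.biUnion_subset.2 fun j _ =>
            Set.Finite.toFinset_subset_toFinset.2 (level_subset_openClusterIn K v j ω))
      _ = (openClusterIn K ω v).ncard := (Set.ncard_eq_toFinset_card _ hfin).symm
  have hm0 : (0 : ℝ) < m := by exact_mod_cast hm
  have hcard : (Finset.Ico m (2 * m)).card = m := by simp; omega
  have hlt : V₀ < ((∑ j ∈ Finset.Ico m (2 * m), (level K v j ω).ncard : ℕ) : ℝ) := by
    push_cast
    calc V₀ = ∑ _j ∈ Finset.Ico m (2 * m), V₀ / m := by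
          rw [Finset.sum_const, hcard, nsmul_eq_mul]; field_simp
      _ < ∑ j ∈ Finset.Ico m (2 * m), ((level K v j ω).ncard : ℝ) :=
          Finset.sum_lt_sum_of_nonempty (by rw [Finset.nonempty_Ico]; omega) hbig
  have : ((∑ j ∈ Finset.Ico m (2 * m), (level K v j ω).ncard : ℕ) : ℝ) ≤ (openClusterIn K ω v).ncard := by
    exact_mod_cast hsum
  linarith

/-! ## Locality: the balls up to radius `n + 1` are read off the edges touching `B(v, n; K)` -/

/-- The steps of an open `K`-path of length `≤ i` from `v`: its start lies in `B(v, 0; K)` and, more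
usefully, appending one open `K`-step to a site of `B(v, t; K)` lands in `B(v, t+1; K)`. [folklore] -/
private theorem mem_ball_succ_of_adj {K : SimpleGraph V} {v a b : V} {t : ℕ} {ω : BondConfig V}
    (ha : a ∈ ball K v t ω) (hab : (openGraph ω ⊓ K).Adj a b) : b ∈ ball K v (t + 1) ω := by
  obtain ⟨w, hw⟩ := ha
  exact ⟨w.concat hab, by rw [SimpleGraph.Walk.length_concat]; omega⟩

/-- One direction of locality, by induction along a path of the second configuration: if `ω` and `ω'`
agree on every `K`-edge touching `B(v, n; K)(ω)`, then an open `K`-path of `ω'` of length `ℓ` started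
at a site of `B(v, t; K)(ω)` with `t + ℓ ≤ n + 1` ends in `B(v, t + ℓ; K)(ω)`. [folklore] -/
private theorem mem_ball_of_walk_of_agree {K : SimpleGraph V} {v : V} {n : ℕ} {ω ω' : BondConfig V}
    (h : ∀ e ∈ K.edgeSet, (∃ y ∈ ball K v n ω, y ∈ e) → (e ∈ ω ↔ e ∈ ω'))
    {a z : V} (w : (openGraph ω' ⊓ K).Walk a z) :
    ∀ {t : ℕ}, a ∈ ball K v t ω → t + w.length ≤ n + 1 → z ∈ ball K v (t + w.length) ω := by
  induction w with
  | nil => intro t ha _; simpa using ha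
  | @cons a b c hab p ih =>
    intro t ha ht
    rw [SimpleGraph.Walk.length_cons] at ht ⊢
    have han : a ∈ ball K v n ω := ball_mono (by omega) ω ha
    -- the edge `s(a,b)` is a `K`-edge touching `B(v,n;K)(ω)`, open in `ω'`, hence open in `ω`
    have hK : s(a, b) ∈ K.edgeSet := ((SimpleGraph.inf_adj _ _ _ _).1 hab).2
    have hω' : s(a, b) ∈ ω' := ((openGraph_adj ω' a b).1 ((SimpleGraph.inf_adj _ _ _ _).1 hab).1).1
    have hω : s(a, b) ∈ ω := (h _ hK ⟨a, han, Sym2.mem_mk_left a b⟩).2 hω'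
    have hab' : (openGraph ω ⊓ K).Adj a b :=
      (SimpleGraph.inf_adj _ _ _ _).2 ⟨(openGraph_adj ω a b).2 ⟨hω, hab.ne⟩, ((SimpleGraph.inf_adj _ _ _ _).1 hab).2⟩
    have hb : b ∈ ball K v (t + 1) ω := mem_ball_succ_of_adj ha hab'
    have := ih hb (by omega)
    rwa [show t + 1 + p.length = t + (p.length + 1) by omega] at this

/-- **Locality of the intrinsic balls.** If `ω` and `ω'` agree on every `K`-edge having an endpoint in
`B(v, n; K)(ω)`, then `B(v, i; K)(ω') = B(v, i; K)(ω)` for every `i ≤ n + 1`: the ball of radius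
`n + 1` (and everything inside it) is read off the states of the edges touching the ball of radius `n`
(the measurability input of Kozma–Nachmias' regeneration argument, §3.2: "define `G₂` to be `G` with
all edges needed to calculate `B(0,j;G)` removed"). [cite: KozmaNachmias2009, §3.2 (edges needed to calculate B(0,j;G))] -/
theorem ball_eq_of_agree {K : SimpleGraph V} {v : V} {n : ℕ} {ω ω' : BondConfig V}
    (h : ∀ e ∈ K.edgeSet, (∃ y ∈ ball K v n ω, y ∈ e) → (e ∈ ω ↔ e ∈ ω')) {i : ℕ} (hi : i ≤ n + 1) :
    ball K v i ω' = ball K v i ω := by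
  classical
  ext z
  constructor
  · rintro ⟨w, hw⟩
    have := mem_ball_of_walk_of_agree h w (t := 0) (self_mem_ball K v 0 ω) (by omega)
    exact ball_mono (by omega) ω this
  · rintro ⟨w, hw⟩
    -- every edge of `w` is a `K`-edge touching `B(v,n;K)(ω)` (its earlier endpoint is within distance
    -- `≤ |w| - 1 ≤ n`), hence has the same state in `ω'`
    refine ⟨w.transfer (openGraph ω' ⊓ K) fun e he => ?_, by rwa [SimpleGraph.Walk.length_transfer]⟩
    induction e using Sym2.ind with
    | h a b =>
      have hadj : (openGraph ω ⊓ K).Adj a b := w.adj_of_mem_edges he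
      have hK : K.Adj a b := ((SimpleGraph.inf_adj _ _ _ _).1 hadj).2
      have hω : s(a, b) ∈ ω := ((openGraph_adj ω a b).1 ((SimpleGraph.inf_adj _ _ _ _).1 hadj).1).1
      -- `a` lies on `w`, within distance `< |w|` of `v` unless it is the endpoint; either way one of
      -- `a`, `b` is a non-final vertex of `w`, at distance `≤ |w| - 1 ≤ n`
      have htouch : ∃ y ∈ ball K v n ω, y ∈ s(a, b) := by
        -- one of `a`, `b` is not the final vertex `z` of `w`; its prefix of `w` has length `< |w| ≤ n+1`
        have hmk : ∀ c ∈ w.support, c ≠ z → c ∈ ball K v n ω := fun c hc hcz =>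
          ⟨w.takeUntil c hc, by have := w.length_takeUntil_lt_length hc hcz; omega⟩
        by_cases haz : a = z
        · have hbz : b ≠ z := fun hbz => hK.ne (haz.trans hbz.symm)
          exact ⟨b, hmk b (w.snd_mem_support_of_mem_edges he) hbz, Sym2.mem_mk_right a b⟩
        · exact ⟨a, hmk a (w.fst_mem_support_of_mem_edges he) haz, Sym2.mem_mk_left a b⟩
      have hω' : s(a, b) ∈ ω' := (h _ hK htouch).1 hω
      exact (SimpleGraph.mem_edgeSet _).2
        ((SimpleGraph.inf_adj _ _ _ _).2 ⟨(openGraph_adj ω' a b).2 ⟨hω', hK.ne⟩, hK⟩)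

/-- Under the same agreement the levels up to `n + 1` coincide. [cite: KozmaNachmias2009, §3.2 proof of Thm. 1.2(ii)] -/
theorem level_eq_of_agree {K : SimpleGraph V} {v : V} {n : ℕ} {ω ω' : BondConfig V}
    (h : ∀ e ∈ K.edgeSet, (∃ y ∈ ball K v n ω, y ∈ e) → (e ∈ ω ↔ e ∈ ω')) {i : ℕ} (hi : i ≤ n + 1) :
    level K v i ω' = level K v i ω := by
  -- `level i = ball i ∖ ball (i-1)` (and `level 0 = ball 0`)
  have key : ∀ (ω₀ : BondConfig V) (z : V), z ∈ level K v i ω₀ ↔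
      z ∈ ball K v i ω₀ ∧ ∀ i', i' < i → z ∉ ball K v i' ω₀ := by
    intro ω₀ z
    constructor
    · intro hz
      exact ⟨level_subset_ball K v i ω₀ hz, fun i' hi' => not_mem_ball_of_mem_level hz hi'⟩
    · rintro ⟨hz, hnot⟩
      obtain ⟨hr, hd⟩ := mem_ball_iff.1 hz
      exact ⟨hr, le_antisymm hd (not_lt.1 fun hlt => hnot _ hlt (mem_ball_iff.2 ⟨hr, le_rfl⟩))⟩
  ext z
  rw [key ω' z, key ω z, ball_eq_of_agree h hi]
  refine and_congr_right fun _ => forall_congr' fun i' => imp_congr_right fun hi' => ?_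
  rw [ball_eq_of_agree h (by omega)]

/-! ## The geodesic suffix: leaving `B(v, n; K)` for good -/

/-- Deleting edges enlarges distances: if `K' ≤ K` and `z` is `K'`-reachable from `x`, then
`dist_K(x,z) ≤ dist_{K'}(x,z)`. [folklore] -/
private theorem dist_le_dist_of_le {K K' : SimpleGraph V} (hK : K' ≤ K) {ω : BondConfig V} {x z : V}
    (hr : (openGraph ω ⊓ K').Reachable x z) :
    (openGraph ω ⊓ K).dist x z ≤ (openGraph ω ⊓ K').dist x z := by
  obtain ⟨w, hw⟩ := hr.exists_walk_length_eq_dist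
  have h := SimpleGraph.dist_le (w.transfer (openGraph ω ⊓ K) fun e he =>
    SimpleGraph.edgeSet_subset_edgeSet.2 (inf_le_inf_left (openGraph ω) hK) (w.edges_subset_edgeSet he))
  rw [SimpleGraph.Walk.length_transfer] at h
  exact h.trans hw.le

/-- The set of pairs having an endpoint in `S` ("edges touching `S`"; Kozma–Nachmias' "edges needed to
calculate `B(0,j;G)`" are the `G`-edges touching `B(0,j-1;G)`). [cite: KozmaNachmias2009, §3.2 (the graph G₂)] -/
def touching (S : Set V) : Set (Sym2 V) := {e | ∃ y ∈ S, y ∈ e}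

/-- **Geodesic suffix (Kozma–Nachmias' regeneration step, deterministic part).** Let
`S = B(v, n; K)(ω)` and let `K' = K ∖ {edges touching S}`.  If `ω ∈ H_v(R; K)` with `n + 1 ≤ R`,
then some site `x` of the level `∂B(v, n+1; K)(ω)` satisfies `ω ∈ H_x(R - (n+1); K')`: the part of a
geodesic from `v` beyond its `(n+1)`-st vertex `x` uses no edge touching `S` (all its vertices are at
distance `≥ n+1` from `v`), so it is an open `K'`-path, and `dist_{K'}(x, ·) ≥ dist_K(x, ·) ≥ R-(n+1)`
along it (KN09 §3.2: "at least one vertex `v` of level `j` reaches level `3^{k-1}` in `G₂`").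
[cite: KozmaNachmias2009, §3.2 proof of Thm. 1.2(ii) (the graph G₂)] -/
theorem exists_far_deleteEdges {K : SimpleGraph V} {v : V} {n R : ℕ} {ω : BondConfig V}
    (hω : ω ∈ far K v R) (hn : n + 1 ≤ R) :
    ∃ x ∈ level K v (n + 1) ω, ω ∈ far (K.deleteEdges (touching (ball K v n ω))) x (R - (n + 1)) := by
  obtain ⟨z, hz, hRz⟩ := hω
  obtain ⟨w, hw⟩ := hz.exists_walk_length_eq_dist
  have hlen : n + 1 ≤ w.length := by rw [hw]; exact hn.trans hRz
  have hdx : (openGraph ω ⊓ K).dist v (w.getVert (n + 1)) = n + 1 :=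
    dist_getVert_of_length_eq_dist w hw hlen
  have hxlev : w.getVert (n + 1) ∈ level K v (n + 1) ω := ⟨⟨w.take (n + 1)⟩, hdx⟩
  refine ⟨w.getVert (n + 1), hxlev, ?_⟩
  -- the vertices of the suffix of the geodesic are at distance `≥ n+1` from `v`
  have hfar : ∀ c ∈ (w.drop (n + 1)).support, c ∉ ball K v n ω := by
    intro c hc hcball
    rw [SimpleGraph.Walk.mem_support_iff_exists_getVert] at hc
    obtain ⟨k, hkc, hk⟩ := hc
    rw [SimpleGraph.Walk.drop_getVert] at hkc
    rw [SimpleGraph.Walk.drop_length] at hk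
    have hdk : (openGraph ω ⊓ K).dist v (w.getVert (n + 1 + k)) = n + 1 + k :=
      dist_getVert_of_length_eq_dist w hw (by omega)
    have := (mem_ball_iff.1 hcball).2
    rw [← hkc, hdk] at this
    omega
  -- hence the suffix uses no edge touching `B(v,n;K)`: it is an open `K'`-path
  have hq : ∀ e ∈ (w.drop (n + 1)).edges,
      e ∈ (openGraph ω ⊓ K.deleteEdges (touching (ball K v n ω))).edgeSet := by
    intro e he
    induction e using Sym2.ind with
    | h a b =>
      have hadj : (openGraph ω ⊓ K).Adj a b := (w.drop (n + 1)).adj_of_mem_edges he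
      have hK : K.Adj a b := ((SimpleGraph.inf_adj _ _ _ _).1 hadj).2
      have hωab : (openGraph ω).Adj a b := ((SimpleGraph.inf_adj _ _ _ _).1 hadj).1
      have ha : a ∉ ball K v n ω := hfar a ((w.drop (n + 1)).fst_mem_support_of_mem_edges he)
      have hb : b ∉ ball K v n ω := hfar b ((w.drop (n + 1)).snd_mem_support_of_mem_edges he)
      have hnt : s(a, b) ∉ touching (ball K v n ω) := by
        rintro ⟨y, hy, hye⟩
        rcases Sym2.mem_iff.1 hye with rfl | rfl
        · exact ha hy
        · exact hb hy
      exact (SimpleGraph.mem_edgeSet _).2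
        ((SimpleGraph.inf_adj _ _ _ _).2 ⟨hωab, SimpleGraph.deleteEdges_adj.2 ⟨hK, hnt⟩⟩)
  have hreach' : (openGraph ω ⊓ K.deleteEdges (touching (ball K v n ω))).Reachable (w.getVert (n + 1)) z :=
    ⟨(w.drop (n + 1)).transfer _ hq⟩
  refine ⟨z, hreach', ?_⟩
  -- `dist_{K'}(x,z) ≥ dist_K(x,z) ≥ |w| - (n+1) ≥ R - (n+1)`
  have h1 : (openGraph ω ⊓ K).dist (w.getVert (n + 1)) z ≤
      (openGraph ω ⊓ K.deleteEdges (touching (ball K v n ω))).dist (w.getVert (n + 1)) z :=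
    dist_le_dist_of_le (SimpleGraph.deleteEdges_le _) hreach'
  have h2 : (openGraph ω ⊓ K).dist v z ≤
      (openGraph ω ⊓ K).dist v (w.getVert (n + 1)) + (openGraph ω ⊓ K).dist (w.getVert (n + 1)) z :=
    (show (openGraph ω ⊓ K).Reachable v (w.getVert (n + 1)) from ⟨w.take (n + 1)⟩).dist_triangle_left z
  omega

/-! ## Determination by the edges of `K`, and measurability -/

/-- Restricting the configuration to `E(K)` does not change the open `K`-graph. [folklore] -/
private theorem openGraph_inter_inf (K : SimpleGraph V) (ω : BondConfig V) :
    openGraph (ω ∩ K.edgeSet) ⊓ K = openGraph ω ⊓ K := by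
  rw [openGraph_inter_edgeSet, inf_assoc, inf_idem]

/-- `H_v(r; K)` only reads the edges of `K`. [folklore] -/
private theorem far_eq_preimage_inter (K : SimpleGraph V) (v : V) (r : ℕ) :
    far K v r = (fun ω : BondConfig V => ω ∩ K.edgeSet) ⁻¹' far K v r := by
  ext ω
  simp only [Set.mem_preimage, far, Set.mem_setOf_eq, openGraph_inter_inf]

/-- **`H_v(r; K)` is determined by the states of the edges of `K`.** [cite: KozmaNachmias2009, §1.3 (H(r;G) and Γ(r))] -/
theorem determinedBy_far (K : SimpleGraph V) (v : V) (r : ℕ) : DeterminedBy (far K v r) K.edgeSet := by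
  rw [far_eq_preimage_inter]
  exact determinedBy_preimage_inter _ _

/-- The cylinder event "all edges of the `K`-walk `w` are open". [folklore] -/
private theorem measurableSet_forall_mem_edges {K : SimpleGraph V} {u z : V} (w : K.Walk u z) :
    MeasurableSet {ω : BondConfig V | ∀ e ∈ w.edges, e ∈ ω} := by
  classical
  have : {ω : BondConfig V | ∀ e ∈ w.edges, e ∈ ω} = ⋂ e ∈ w.edges.toFinset, {ω : BondConfig V | e ∈ ω} := by
    ext ω
    simp only [Set.mem_setOf_eq, Set.mem_iInter, List.mem_toFinset]
  rw [this]
  exact Finset.measurableSet_biInter _ fun e _ => measurableSet_mem e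

/-- `{z ∈ B(v, i; K)}` as a finite union of cylinders over the `K`-walks of length `≤ i`
(`K` locally finite). [folklore] -/
private theorem setOf_mem_ball_eq [DecidableEq V] (K : SimpleGraph V) [K.LocallyFinite] (v z : V) (i : ℕ) :
    {ω : BondConfig V | z ∈ ball K v i ω} =
      ⋃ w ∈ K.finsetWalkLengthLT (i + 1) v z, {ω : BondConfig V | ∀ e ∈ w.edges, e ∈ ω} := by
  ext ω
  simp only [Set.mem_setOf_eq, Set.mem_iUnion, SimpleGraph.mem_finsetWalkLengthLT_iff, exists_prop]
  constructor
  · rintro ⟨w, hw⟩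
    refine ⟨w.transfer K fun e he => SimpleGraph.edgeSet_subset_edgeSet.2 inf_le_right
        (w.edges_subset_edgeSet he), by rw [SimpleGraph.Walk.length_transfer]; omega, fun e he => ?_⟩
    rw [SimpleGraph.Walk.edges_transfer] at he
    induction e using Sym2.ind with
    | h a b => exact ((openGraph_adj ω a b).1 ((SimpleGraph.inf_adj _ _ _ _).1 (w.adj_of_mem_edges he)).1).1
  · rintro ⟨w, hw, hopen⟩
    refine ⟨w.transfer (openGraph ω ⊓ K) fun e he => ?_, by rw [SimpleGraph.Walk.length_transfer]; omega⟩
    induction e using Sym2.ind with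
    | h a b =>
      have hK : K.Adj a b := w.adj_of_mem_edges he
      exact (SimpleGraph.mem_edgeSet _).2
        ((SimpleGraph.inf_adj _ _ _ _).2 ⟨(openGraph_adj ω a b).2 ⟨hopen _ he, hK.ne⟩, hK⟩)

/-- `{z ∈ B(v, i; K)}` is measurable (`K` locally finite). [folklore] -/
private theorem measurableSet_mem_ball [DecidableEq V] (K : SimpleGraph V) [K.LocallyFinite] (v z : V) (i : ℕ) :
    MeasurableSet {ω : BondConfig V | z ∈ ball K v i ω} := by
  rw [setOf_mem_ball_eq]
  exact Finset.measurableSet_biUnion _ fun w _ => measurableSet_forall_mem_edges w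

/-- `H_v(r; K)` as "some site of `C_K(v)` lies outside `B(v, r-1; K)`" (`r ≥ 1`). [folklore] -/
private theorem far_succ_eq (K : SimpleGraph V) (v : V) (n : ℕ) :
    far K v (n + 1) = ⋃ z, (openConnVia K v z \ {ω | z ∈ ball K v n ω}) := by
  ext ω
  simp only [far, Set.mem_setOf_eq, Set.mem_iUnion, Set.mem_sdiff, openConnVia, mem_openClusterIn_iff,
    mem_ball_iff, not_and, not_le]
  constructor
  · rintro ⟨z, hz, hr⟩
    exact ⟨z, hz, fun _ => by omega⟩
  · rintro ⟨z, hz, hr⟩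
    exact ⟨z, hz, by have := hr hz; omega⟩

/-- **`H_v(r; K)` is measurable** (`V` countable, `K` locally finite). [cite: KozmaNachmias2009, §1.3 (H(r;G))] -/
theorem measurableSet_far [Countable V] [DecidableEq V] (K : SimpleGraph V) [K.LocallyFinite] (v : V)
    (r : ℕ) : MeasurableSet (far K v r) := by
  cases r with
  | zero => rw [far_zero]; exact MeasurableSet.univ
  | succ n =>
    rw [far_succ_eq]
    exact MeasurableSet.iUnion fun z =>
      (measurableSet_openConnVia K v z).diff (measurableSet_mem_ball K v z n)

end Chemical

end Literature.Probability.Percolation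

end
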